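import Mathlib
import HarnessLib
import Literature.NumberTheory.DiophantineGeometry.RothPrelim
import Literature.NumberTheory.DiophantineGeometry.RothTaylor
import Literature.NumberTheory.DiophantineGeometry.RothLemmaTransport
import Literature.NumberTheory.DiophantineGeometry.RothLemmaDecomp
import Literature.NumberTheory.DiophantineGeometry.RothLemmaOne
import Literature.NumberTheory.DiophantineGeometry.RothLemmaTop
import Literature.NumberTheory.DiophantineGeometry.RothLemmaHeights

/-!
# Roth's theorem after Schmidt (LNM 785, Ch. V) — Roth's Lemma (Theorem 10A)

Source: W. M. Schmidt, *Diophantine Approximation*, LNM 785 (1980), Ch. V §10, Theorem 10A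
(Roth 1955) with Lemma 10B, pp. 129–133 [Schmidt1980].

**Theorem 10A (Roth's Lemma)**, with `γ = 1` ("usually stated with `γ = 1`", Remark p. 130),
`0`-indexed: let `0 < ε < 1/12`, `m ≥ 1`, `ω = ω(m, ε) = 24·2^{-m}(ε/12)^{2^{m-1}}`,
`r₀, …, r_{m-1}` positive integers with `r_{h+1} ≤ ω r_h` (10.3), `p_h/q_h` in lowest terms with
`q_h^{r_h} ≥ q₀^{r₀}` (10.4) and `q_h^ω ≥ 2^{3m}` (10.5), and `P ≠ 0` an integer polynomial of
degree `≤ r_h` in `X_h` with `|P| ≤ q₀^{ωr₀}` (10.6). Then the index of `P` at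
`(p₀/q₀, …, p_{m-1}/q_{m-1})` w.r.t. `(r₀, …, r_{m-1})` is `≤ ε`: some `P_i` with
`Σ i_h/r_h ≤ ε` does not vanish there (`Roth.rothLemma`, in the form consumed by
`Roth.roth_of_rothLemma` of `RothAssembly.lean`).

Proof by induction on `m` as printed. `m = 1`: `Roth.rothLemma_oneVar` (`RothLemmaOne.lean`,
Gauss's Lemma). Step `m ⇒ m + 1`: the decomposition (10.8), Lemma 9A and the integer Wronskian
`W = det (P_{(μ_s, ν_j)})` with `W = V·U` over `ℝ` (`Roth.exists_wronskian_package`,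
`RothLemmaDecomp.lean`); Lemma 10B: the height estimate (10.10) `|W| ≤ q₀^{2ωr₀k}`
(`Roth.height_det_le`, `RothLemmaHeights.lean`) and the inductive hypotheses applied — instead of
Schmidt's integral splitting `W = V*U*` by Gauss's Lemma — to the integer slices
`V* = ` coefficient of `X_m^{ν₀}` in `W` (`= u_{ν₀} V`) and `U* = ` coefficient of `X'^{κ₀}` in `W`
(`= v_{κ₀} U`), which are integer polynomials of height `≤ |W|` with the same indices as `V`, `U`
(`RothLemmaTransport.lean`); this gives a non-vanishing `W_i` with `Σ i_h/r_h ≤ kε²/6`, and the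
"Completion of the proof" (pp. 132–133; `Roth.rothLemma_of_detWitness`, adapted from
`Roth.rothLemma_of_wronskianData` of `RothLemmaTop.lean` to a bare determinant witness and to
column orders `ν_j ≤ j`) yields index `≤ ε`.

## References

* [Schmidt1980] W. M. Schmidt, *Diophantine Approximation*, LNM 785, Springer 1980, Ch. V §10,
  Theorem 10A, Lemma 10B, pp. 129–133.
* [Roth1955] K. F. Roth, *Rational approximations to algebraic numbers*, Mathematika 2 (1955).
-/

noncomputable section

open MvPolynomial Finset

namespace Literature.NumberTheory.DiophantineGeometry

namespace Roth

/-! ### Degrees of determinants -/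

/-- The partial degrees of a determinant: `deg_{X_h} det N ≤ k · d` if all entries have
`deg_{X_h} ≤ d`. [folklore] -/
theorem degreeOf_det_le {σ : Type*} {R : Type*} [CommRing R] {k : ℕ}
    (N : Matrix (Fin k) (Fin k) (MvPolynomial σ R)) (x : σ) (d : ℕ)
    (h : ∀ i j, degreeOf x (N i j) ≤ d) : degreeOf x N.det ≤ k * d := by
  classical
  rw [Matrix.det_apply]
  refine (degreeOf_sum_le _ _ _).trans (Finset.sup_le fun τ _ => ?_)
  have hsmul : degreeOf x (Equiv.Perm.sign τ • ∏ i, N (τ i) i) ≤ degreeOf x (∏ i, N (τ i) i) := by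
    rcases Int.units_eq_one_or (Equiv.Perm.sign τ) with h1 | h1 <;> rw [h1]
    · rw [one_smul]
    · rw [Units.smul_def, Units.val_neg, Units.val_one, neg_one_smul, degreeOf_neg]
  refine hsmul.trans ((degreeOf_prod_le _ _ _).trans ?_)
  calc ∑ i, degreeOf x (N (τ i) i) ≤ ∑ _i : Fin k, d := sum_le_sum fun i _ => h _ _
    _ = k * d := by simp

/-! ### Completion of the proof of Theorem 10A from a determinant witness -/

/-- **Completion of the proof of Theorem 10A** (Schmidt, pp. 132–133), from a bare witness for
the Wronskian: let `P ∈ ℤ[X₀,…,X_{n+1}]` (`m = n + 2 ≥ 2` variables), weights with (10.3),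
`1 ≤ k ≤ r_{m} + 1`, multi-indices `μ_s` in the first `n + 1` variables with `|μ_s| ≤ s` and orders
`ν_j ≤ j` in the last one, and `W = det (P_{(μ_s, ν_j)})`. If some `W_i(a) ≠ 0` with
`Σ i_h/r_h ≤ kε²/6` (Lemma 10B's conclusion), then some `P_i(a) ≠ 0` with `Σ i_h/r_h ≤ ε`.
(Adapted from `Roth.rothLemma_of_wronskianData`: Lemma 6A, (10.9), (10.3), `ω ≤ ε²/24`, and
Cases I/II `Roth.lt_of_sum_max_sub_lt`.) [cite: Schmidt1980, Ch. V Thm 10A (completion of the proof, pp. 132–133)] -/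
theorem rothLemma_of_detWitness {n : ℕ} (ε : ℝ) (hε0 : 0 < ε) (hε12 : ε < 1 / 12)
    (r : Fin (n + 2) → ℕ) (hr0 : ∀ h, 0 < r h)
    (hr : ∀ h h' : Fin (n + 2), (h : ℕ) + 1 = h' → (r h' : ℝ) ≤ omega (n + 2) ε * r h)
    (a : Fin (n + 2) → ℝ) (P : MvPolynomial (Fin (n + 2)) ℤ)
    (k : ℕ) (hk : 0 < k) (hkr : k ≤ r (Fin.last (n + 1)) + 1)
    (μ : Fin k → (Fin (n + 1) →₀ ℕ)) (hμdeg : ∀ s, ∑ h, μ s h ≤ (s : ℕ))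
    (ν : Fin k → ℕ) (hν : ∀ j, ν j ≤ (j : ℕ))
    (hWwit : ∃ iW : Fin (n + 2) →₀ ℕ, wt r iW ≤ k * ε ^ 2 / 6 ∧
      aeval a (hasseD iW
        (Matrix.det (Matrix.of fun s j : Fin k => hasseD (snocF (μ s) (ν j)) P))) ≠ 0) :
    ∃ i : Fin (n + 2) →₀ ℕ, wt r i ≤ ε ∧ aeval a (hasseD i P) ≠ 0 := by
  classical
  set L := Fin.last (n + 1) with hL
  set ω := omega (n + 2) ε with hω
  set M : Matrix (Fin k) (Fin k) (MvPolynomial (Fin (n + 2)) ℤ) :=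
    Matrix.of fun s j : Fin k => hasseD (snocF (μ s) (ν j)) P with hM
  have hkR : (0 : ℝ) < k := by exact_mod_cast hk
  have hrL : (0 : ℝ) < r L := by exact_mod_cast hr0 L
  -- `ω ≤ ε²/24 < 1`
  have hωle : ω ≤ ε ^ 2 / 24 := omega_le_sq_div (n + 2) (by omega) hε0.le (by linarith)
  have hω1 : ω ≤ 1 := by nlinarith
  have hω0 : 0 < ω := omega_pos hε0
  obtain ⟨iW, hiWwt, hWwit⟩ := hWwit
  -- suppose the conclusion fails; then the index of `P` exceeds `ε`
  by_contra hcon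
  push Not at hcon
  obtain ⟨θ, hθε, hθ⟩ := exists_indexGe_gt P a r ε (fun i hi => by
    by_contra h; exact absurd (hcon i hi) (by simpa using h))
  have hθ0 : 0 ≤ θ := by linarith
  -- the index of `W` is `≥ Σ_j max(θ - ω - ν_j/r_m, 0)` (Lemma 6A, (10.9), (10.3))
  have hanti := antitone_of_succ_le hω1 r hr
  have hμwt : ∀ s, wt (fun h : Fin (n + 1) => r h.castSucc) (μ s) ≤ ω := by
    intro s
    set L' : Fin (n + 2) := (Fin.last n).castSucc with hL'
    have hrL' : (0 : ℝ) < r L' := by exact_mod_cast hr0 L'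
    have h1 : wt (fun h : Fin (n + 1) => r h.castSucc) (μ s) ≤ (∑ h, (μ s h : ℝ)) / r L' := by
      rw [wt, Finset.sum_div]
      apply Finset.sum_le_sum
      intro h _
      have hle : h.castSucc ≤ L' := by
        rw [hL', Fin.le_def]
        simp only [Fin.val_castSucc, Fin.val_last]
        exact Nat.lt_succ_iff.mp h.isLt
      have : (r L' : ℝ) ≤ r h.castSucc := by exact_mod_cast hanti _ _ hle
      exact div_le_div_of_nonneg_left (Nat.cast_nonneg _) hrL' this
    have h2 : (∑ h, (μ s h : ℝ)) ≤ (k : ℝ) - 1 := by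
      have : ((∑ h, μ s h : ℕ) : ℝ) ≤ (s : ℕ) := by exact_mod_cast hμdeg s
      push_cast at this
      have hsk : ((s : ℕ) : ℝ) + 1 ≤ k := by exact_mod_cast s.isLt
      linarith
    have h3 : (k : ℝ) - 1 ≤ r L := by
      have : (k : ℝ) ≤ r L + 1 := by exact_mod_cast hkr
      linarith
    have h4 : (r L : ℝ) ≤ ω * r L' := hr L' L (by simp [hL', hL])
    calc wt (fun h : Fin (n + 1) => r h.castSucc) (μ s) ≤ (∑ h, (μ s h : ℝ)) / r L' := h1
      _ ≤ (r L : ℝ) / r L' := div_le_div_of_nonneg_right (h2.trans h3) hrL'.le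
      _ ≤ ω := by rw [div_le_iff₀ hrL']; exact h4
  set c : Fin k → ℝ := fun j => θ - ω - (ν j : ℝ) / r L with hc
  have hMind : ∀ s j, IndexGe (M s j) a r (c j) := by
    intro s j
    simp only [hM, Matrix.of_apply, hc]
    refine (hθ.hasseD (snocF (μ s) (ν j))).mono ?_
    rw [wt_snocF]
    linarith [hμwt s]
  have hWind : IndexGe M.det a r (∑ j, max (c j) 0) := indexGe_det_of_columns M a r c hMind
  -- compare: `Σ_j max(θ - ω - ν_j/r_m, 0) ≤ kε²/6`
  have hΘ : ∑ j : Fin k, max (c j) 0 ≤ k * ε ^ 2 / 6 := by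
    by_contra hlt
    push Not at hlt
    exact hWwit (hWind iW (lt_of_le_of_lt hiWwt hlt))
  -- (10.11) and Cases I/II
  have hsum : ∑ j ∈ Finset.range k, max (θ - j / r L) 0 < k * ε ^ 2 / 4 := by
    have h1 : ∑ j ∈ Finset.range k, max (θ - j / r L) 0 ≤ ∑ j : Fin k, (max (c j) 0 + ω) := by
      rw [← Fin.sum_univ_eq_sum_range]
      apply Finset.sum_le_sum
      intro j _
      simp only [hc]
      have hνj : (ν j : ℝ) / r L ≤ (j : ℕ) / r L :=
        div_le_div_of_nonneg_right (by exact_mod_cast hν j) hrL.le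
      rcases le_or_gt 0 (θ - ω - (ν j : ℝ) / r L) with h | h
      · rw [max_eq_left h]
        refine max_le ?_ ?_ <;> linarith
      · rw [max_eq_right h.le, zero_add]
        exact max_le (by linarith) hω0.le
    have h2 : ∑ j : Fin k, (max (c j) 0 + ω) = (∑ j : Fin k, max (c j) 0) + k * ω := by
      rw [Finset.sum_add_distrib, Finset.sum_const, Finset.card_univ, Fintype.card_fin,
        nsmul_eq_mul]
    rw [h2] at h1
    have h3 : (k : ℝ) * ω ≤ k * (ε ^ 2 / 24) := mul_le_mul_of_nonneg_left hωle hkR.le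
    nlinarith
  have hθlt : θ < ε :=
    lt_of_sum_max_sub_lt hk hkr (hr0 L) hε0 (by linarith) hθ0 hsum
  linarith

/-! ### Evaluation of integer polynomials after base change -/

/-- Values of `P_i` at a real point agree with those of the base-changed polynomial. [folklore] -/
theorem aeval_hasseD_eq_aeval_hasseD_map {σ : Type*} [Fintype σ] (a : σ → ℝ) (i : σ →₀ ℕ)
    (Q : MvPolynomial σ ℤ) :
    aeval a (hasseD i Q) = aeval a (hasseD i (map (Int.castRingHom ℝ) Q)) := by
  rw [← map_hasseD, ← algebraMap_int_eq, aeval_map_algebraMap]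

/-- A non-zero scalar multiple does not change the vanishing of the `P_i(a)`. [folklore] -/
theorem aeval_hasseD_ne_zero_of_smul {σ : Type*} [Fintype σ] (a : σ → ℝ) (i : σ →₀ ℕ)
    {Q : MvPolynomial σ ℤ} {V : MvPolynomial σ ℝ} {u : ℝ}
    (hmap : map (Int.castRingHom ℝ) Q = u • V) (hne : aeval a (hasseD i Q) ≠ 0) :
    aeval a (hasseD i V) ≠ 0 := by
  rw [aeval_hasseD_eq_aeval_hasseD_map, hmap, hasseD_smul, map_smul, smul_eq_mul] at hne
  exact right_ne_zero_of_mul hne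

/-! ### The case `m = 1` in the form of the induction -/

/-- **Theorem 10A for one variable** in the `0`-indexed form of the induction (from
`Roth.rothLemma_oneVar`): `|P| ≤ q₀^{ω(1,ε)r₀} = q₀^{εr₀}`, `q₀^{ε} ≥ 8`, `(p₀,q₀)=1` give some
`P_{(ℓ)}(p₀/q₀) ≠ 0` with `ℓ/r₀ ≤ ε`. [cite: Schmidt1980, Ch. V Thm 10A (case m = 1, p. 130)] -/
theorem rothLemma_base (ε : ℝ) (_hε0 : 0 < ε) (_hε12 : ε < 1 / 12)
    (r : Fin 1 → ℕ) (hr0 : ∀ h, 0 < r h)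
    (p : Fin 1 → ℤ) (q : Fin 1 → ℕ) (hq : ∀ h, 0 < q h)
    (hcop : ∀ h, Nat.Coprime (p h).natAbs (q h))
    (h105 : ∀ h, (2 : ℝ) ^ (3 * 1) ≤ (q h : ℝ) ^ omega 1 ε)
    (P : MvPolynomial (Fin 1) ℤ) (hP : P ≠ 0)
    (hPht : (height P : ℝ) ≤ (q 0 : ℝ) ^ (omega 1 ε * r 0)) :
    ∃ i : Fin 1 →₀ ℕ, wt r i ≤ ε ∧ aeval (fun h => (p h : ℝ) / q h) (hasseD i P) ≠ 0 := by
  classical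
  rw [omega_one] at h105 hPht
  obtain ⟨f, hf⟩ := exists_toMv_eq_of_degreeOf_eq_zero (0 : Fin 1) P
    (fun h hh => absurd (Subsingleton.elim h 0) hh)
  have hf0 : f ≠ 0 := by rintro rfl; exact hP (by rw [← hf, map_zero])
  have hq0R : (0 : ℝ) < q 0 := by exact_mod_cast hq 0
  have hq1 : 1 < q 0 := by
    by_contra hle
    have h1 : q 0 = 1 := le_antisymm (not_lt.mp hle) (hq 0)
    have := h105 0
    rw [h1, Nat.cast_one, Real.one_rpow] at this
    norm_num at this
  have hr0R : (0 : ℝ) < r 0 := by exact_mod_cast hr0 0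
  obtain ⟨ν, hνE, hν⟩ := rothLemma_oneVar (0 : Fin 1) f hf0 (fun h => (p h : ℝ) / q h) (p 0)
    (q 0) hq1 (hcop 0) rfl (ε * r 0) (by rw [hf]; exact hPht)
  refine ⟨Finsupp.single 0 ν, ?_, by rw [← hf]; exact hν⟩
  rw [wt, Fin.sum_univ_one, Finsupp.single_eq_same, div_le_iff₀ hr0R]
  exact hνE

/-! ### The inductive step `m ⇒ m + 1` -/

/-- **The inductive step of Theorem 10A with Lemma 10B** (Schmidt, pp. 130–133), `0`-indexed and
with `γ = 1`: Roth's Lemma for `n + 1` variables (the inductive hypothesis `IH`, in the form of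
the induction) implies Roth's Lemma for `n + 2` variables. The bottom half (decomposition, Lemma 9A,
`W`, (10.10), the inductive application to the slices `V*`, `U*`) is carried out here; the top half
is `Roth.rothLemma_of_detWitness`. [cite: Schmidt1980, Ch. V Thm 10A and Lemma 10B (pp. 130–133)] -/
theorem rothLemma_step (n : ℕ)
    (IH : ∀ (ε : ℝ), 0 < ε → ε < 1 / 12 →
      ∀ (r : Fin (n + 1) → ℕ), (∀ h, 0 < r h) →
        (∀ h h' : Fin (n + 1), (h : ℕ) + 1 = h' → (r h' : ℝ) ≤ omega (n + 1) ε * r h) →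
      ∀ (p : Fin (n + 1) → ℤ) (q : Fin (n + 1) → ℕ), (∀ h, 0 < q h) →
        (∀ h, Nat.Coprime (p h).natAbs (q h)) →
        (∀ h, (q 0 : ℝ) ^ (r 0) ≤ (q h : ℝ) ^ (r h)) →
        (∀ h, (2 : ℝ) ^ (3 * (n + 1)) ≤ (q h : ℝ) ^ omega (n + 1) ε) →
      ∀ (P : MvPolynomial (Fin (n + 1)) ℤ), P ≠ 0 → (∀ h, P.degreeOf h ≤ r h) →
        (height P : ℝ) ≤ (q 0 : ℝ) ^ (omega (n + 1) ε * r 0) →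
        ∃ i : Fin (n + 1) →₀ ℕ, wt r i ≤ ε ∧ aeval (fun h => (p h : ℝ) / q h) (hasseD i P) ≠ 0)
    (ε : ℝ) (hε0 : 0 < ε) (hε12 : ε < 1 / 12)
    (r : Fin (n + 2) → ℕ) (hr0 : ∀ h, 0 < r h)
    (hr : ∀ h h' : Fin (n + 2), (h : ℕ) + 1 = h' → (r h' : ℝ) ≤ omega (n + 2) ε * r h)
    (p : Fin (n + 2) → ℤ) (q : Fin (n + 2) → ℕ) (hq : ∀ h, 0 < q h)
    (hcop : ∀ h, Nat.Coprime (p h).natAbs (q h))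
    (h104 : ∀ h, (q 0 : ℝ) ^ (r 0) ≤ (q h : ℝ) ^ (r h))
    (h105 : ∀ h, (2 : ℝ) ^ (3 * (n + 2)) ≤ (q h : ℝ) ^ omega (n + 2) ε)
    (P : MvPolynomial (Fin (n + 2)) ℤ) (hP : P ≠ 0) (hPdeg : ∀ h, P.degreeOf h ≤ r h)
    (hPht : (height P : ℝ) ≤ (q 0 : ℝ) ^ (omega (n + 2) ε * r 0)) :
    ∃ i : Fin (n + 2) →₀ ℕ, wt r i ≤ ε ∧ aeval (fun h => (p h : ℝ) / q h) (hasseD i P) ≠ 0 := by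
  classical
  set ω := omega (n + 2) ε with hω
  set L := Fin.last (n + 1) with hL
  set a : Fin (n + 2) → ℝ := fun h => (p h : ℝ) / q h with ha
  have hω0 : 0 < ω := omega_pos hε0
  have hωle : ω ≤ ε ^ 2 / 24 := omega_le_sq_div (n + 2) (by omega) hε0.le (by linarith)
  have hω1 : ω ≤ 1 := by nlinarith
  have hε' : 0 < ε ^ 2 / 12 := by positivity
  have hε'12 : ε ^ 2 / 12 < 1 / 12 := by nlinarith
  have hε'ω : 2 * ω ≤ ε ^ 2 / 12 := by linarith
  have homega' : omega (n + 1) (ε ^ 2 / 12) = 2 * ω := omega_pred_sq (n + 2) (by omega) ε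
  have hqR : ∀ h, (0 : ℝ) < q h := fun h => by exact_mod_cast hq h
  have hq1 : ∀ h, (1 : ℝ) ≤ q h := fun h => by exact_mod_cast hq h
  have hanti := antitone_of_succ_le hω1 r hr
  have hrle0 : ∀ h, r h ≤ r 0 := fun h => hanti 0 h (Fin.zero_le _)
  -- the Wronskian package
  obtain ⟨k, hk0, hkL, μ, hμ, ν, hν, V, hV0, U, hU0, hWVU⟩ :=
    exists_wronskian_package P hP (r L) (hPdeg L)
  set W : MvPolynomial (Fin (n + 2)) ℤ :=
    Matrix.det (Matrix.of fun s j : Fin k => hasseD (snocF (μ s) (ν j)) P) with hWdef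
  have hkR : (0 : ℝ) ≤ k := Nat.cast_nonneg _
  -- degrees of `W`
  have hWdeg : ∀ h, degreeOf h W ≤ k * r h := fun h =>
    degreeOf_det_le _ h (r h) fun s j => (degreeOf_hasseD_le' h _ P).trans (hPdeg h)
  -- the height of `W`, (10.10)
  set S : ℕ := ∑ h, r h with hS
  have hWht : height W ≤ k.factorial * (2 ^ S * (2 ^ S * height P)) ^ k :=
    height_det_le _ (2 ^ S) (2 ^ S * height P)
      (fun s j => (card_support_hasseD_le _ P).trans
        ((card_support_le_prod_succ P r hPdeg).trans (prod_succ_le_two_pow univ r)))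
      (fun s j => height_hasseD_le _ P r hPdeg)
  set B : ℝ := (q 0 : ℝ) ^ (ω * r 0) with hB
  have hB0 : 0 ≤ B := Real.rpow_nonneg (hqR 0).le _
  have hB1 : 1 ≤ B := Real.one_le_rpow (hq1 0) (by positivity)
  have h2pow : (2 : ℝ) ^ (3 * (n + 2) * r 0) ≤ B := by
    rw [pow_mul, hB, Real.rpow_mul_natCast (hqR 0).le]
    exact pow_le_pow_left₀ (by positivity) (h105 0) _
  have hkfac : (k.factorial : ℝ) ≤ (2 : ℝ) ^ (r L * k) := by
    have h1 : k.factorial ≤ k ^ k := Nat.factorial_le_pow k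
    have h2 : k ^ k ≤ (2 ^ r L) ^ k :=
      Nat.pow_le_pow_left (hkL.trans (Nat.succ_le_of_lt Nat.lt_two_pow_self)) k
    rw [← pow_mul] at h2
    exact_mod_cast h1.trans h2
  have hWhtR : (height W : ℝ) ≤ B ^ (2 * k) := by
    have h1 : (height W : ℝ) ≤ k.factorial * (2 ^ S * (2 ^ S * height P)) ^ k := by
      exact_mod_cast hWht
    have h2 : (2 : ℝ) ^ S * (2 ^ S * height P) ≤ 2 ^ (2 * S) * B := by
      rw [← mul_assoc, ← pow_add, two_mul]
      exact mul_le_mul_of_nonneg_left hPht (by positivity)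
    have h3 : (k.factorial : ℝ) * (2 ^ S * (2 ^ S * height P)) ^ k ≤
        2 ^ (r L * k) * (2 ^ (2 * S) * B) ^ k :=
      mul_le_mul hkfac (pow_le_pow_left₀ (by positivity) h2 k) (by positivity) (by positivity)
    have h4 : (2 : ℝ) ^ (r L * k) * (2 ^ (2 * S) * B) ^ k = (2 ^ (r L + 2 * S) * B) ^ k := by
      rw [mul_pow, mul_pow, pow_add, mul_pow, ← pow_mul, ← pow_mul]
      ring
    have hS' : S ≤ (n + 2) * r 0 := by
      calc S = ∑ h, r h := hS
        _ ≤ ∑ _h : Fin (n + 2), r 0 := sum_le_sum fun h _ => hrle0 h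
        _ = (n + 2) * r 0 := by simp
    have hexp : r L + 2 * S ≤ 3 * (n + 2) * r 0 := by
      have := hrle0 L
      nlinarith [Nat.zero_le (r 0), Nat.zero_le n]
    have h5 : (2 : ℝ) ^ (r L + 2 * S) ≤ B :=
      (pow_le_pow_right₀ (by norm_num) hexp).trans h2pow
    calc (height W : ℝ) ≤ _ := h1
      _ ≤ _ := h3
      _ = (2 ^ (r L + 2 * S) * B) ^ k := h4
      _ ≤ (B * B) ^ k :=
          pow_le_pow_left₀ (by positivity) (mul_le_mul_of_nonneg_right h5 hB0) k
      _ = B ^ (2 * k) := by rw [← sq, ← pow_mul]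
  -- the slices `V*`, `U*`
  obtain ⟨dU, hdU⟩ := MvPolynomial.ne_zero_iff.mp hU0
  set ν₀ : ℕ := dU 0 with hν₀
  have hu : coeff (Finsupp.single 0 ν₀) U ≠ 0 := by rwa [← finsupp_fin_one_eq dU]
  obtain ⟨κ₀, hκ₀⟩ := MvPolynomial.ne_zero_iff.mp hV0
  set Vs : MvPolynomial (Fin (n + 1)) ℤ := sliceLast ν₀ W with hVs
  set Us : MvPolynomial (Fin 1) ℤ := sliceFirst κ₀ W with hUs
  have hVsmap : map (Int.castRingHom ℝ) Vs = coeff (Finsupp.single 0 ν₀) U • V := by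
    rw [hVs, map_sliceLast, hWVU, sliceLast_sep_mul]
  have hUsmap : map (Int.castRingHom ℝ) Us = coeff κ₀ V • U := by
    rw [hUs, map_sliceFirst, hWVU, sliceFirst_sep_mul]
  have hVs0 : Vs ≠ 0 := by
    intro h0; rw [h0, map_zero] at hVsmap; exact smul_ne_zero hu hV0 hVsmap.symm
  have hUs0 : Us ≠ 0 := by
    intro h0; rw [h0, map_zero] at hUsmap; exact smul_ne_zero hκ₀ hU0 hUsmap.symm
  have hVsdeg : ∀ h : Fin (n + 1), degreeOf h Vs ≤ k * r h.castSucc := fun h =>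
    (degreeOf_sliceLast_le ν₀ W h).trans (hWdeg h.castSucc)
  have hUsdeg : ∀ h : Fin 1, degreeOf h Us ≤ k * r L := fun h => by
    rw [Subsingleton.elim h 0]; exact (degreeOf_sliceFirst_le κ₀ W).trans (hWdeg L)
  have hVsht : (height Vs : ℝ) ≤ B ^ (2 * k) :=
    le_trans (by exact_mod_cast height_sliceLast_le ν₀ W) hWhtR
  have hUsht : (height Us : ℝ) ≤ B ^ (2 * k) :=
    le_trans (by exact_mod_cast height_sliceFirst_le κ₀ W) hWhtR
  -- the inductive hypothesis for `V*`
  set r' : Fin (n + 1) → ℕ := fun h => k * r h.castSucc with hr'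
  obtain ⟨i₁, hi₁wt, hi₁⟩ := IH (ε ^ 2 / 12) hε' hε'12 r' (fun h => Nat.mul_pos hk0 (hr0 _))
    (by
      intro h h' hh
      rw [homega', hr']
      have := hr h.castSucc h'.castSucc (by simpa using hh)
      push_cast
      have hk' : (0 : ℝ) ≤ k * r h.castSucc := by positivity
      nlinarith [mul_le_mul_of_nonneg_left this hkR])
    (fun h => p h.castSucc) (fun h => q h.castSucc) (fun h => hq _) (fun h => hcop _)
    (by
      intro h
      rw [hr']
      dsimp only
      rw [Fin.castSucc_zero', mul_comm k (r 0), mul_comm k (r _), pow_mul, pow_mul]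
      exact pow_le_pow_left₀ (by positivity) (h104 h.castSucc) k)
    (by
      intro h
      rw [homega']
      calc (2 : ℝ) ^ (3 * (n + 1)) ≤ 2 ^ (3 * (n + 2)) := pow_le_pow_right₀ (by norm_num) (by omega)
        _ ≤ (q h.castSucc : ℝ) ^ ω := h105 h.castSucc
        _ ≤ (q h.castSucc : ℝ) ^ (2 * ω) :=
            Real.rpow_le_rpow_of_exponent_le (hq1 _) (by linarith))
    Vs hVs0 hVsdeg
    (by
      rw [homega', hr']
      dsimp only
      rw [Fin.castSucc_zero']
      push_cast
      rw [show 2 * ω * (k * r 0) = ω * r 0 * ((2 * k : ℕ) : ℝ) by push_cast; ring,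
        Real.rpow_mul_natCast (hqR 0).le]
      exact hVsht)
  have hi₁V : aeval (a ∘ Fin.castSucc) (hasseD i₁ V) ≠ 0 :=
    aeval_hasseD_ne_zero_of_smul (a ∘ Fin.castSucc) i₁ hVsmap hi₁
  have hi₁wt' : wt (fun h : Fin (n + 1) => r h.castSucc) i₁ ≤ k * (ε ^ 2 / 12) := by
    have h1 := wt_mul_left k hk0 (fun h : Fin (n + 1) => r h.castSucc) i₁
    have hkR' : (0 : ℝ) < k := by exact_mod_cast hk0
    rw [show (fun h : Fin (n + 1) => k * r h.castSucc) = r' from rfl] at h1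
    rw [h1, div_le_iff₀ hkR'] at hi₁wt
    linarith
  -- the case `m = 1` for `U*`
  obtain ⟨i₂, hi₂wt, hi₂⟩ := rothLemma_base (ε ^ 2 / 12) hε' hε'12 (fun _ : Fin 1 => k * r L)
    (fun _ => Nat.mul_pos hk0 (hr0 L)) (fun _ => p L) (fun _ => q L) (fun _ => hq L)
    (fun _ => hcop L)
    (by
      intro h
      rw [omega_one]
      calc (2 : ℝ) ^ (3 * 1) ≤ 2 ^ (3 * (n + 2)) := pow_le_pow_right₀ (by norm_num) (by omega)
        _ ≤ (q L : ℝ) ^ ω := h105 L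
        _ ≤ (q L : ℝ) ^ (ε ^ 2 / 12) := Real.rpow_le_rpow_of_exponent_le (hq1 _) (by linarith))
    Us hUs0
    (by
      rw [omega_one]
      push_cast
      refine hUsht.trans ?_
      -- `B^{2k} ≤ (q_L^{ω r_L})^{2k} = q_L^{2ωk r_L} ≤ q_L^{(ε²/12) k r_L}`
      have hBL : B ≤ (q L : ℝ) ^ (ω * r L) := by
        rw [hB, mul_comm ω (r 0 : ℝ), mul_comm ω (r L : ℝ), Real.rpow_mul (hqR 0).le,
          Real.rpow_mul (hqR L).le, Real.rpow_natCast, Real.rpow_natCast]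
        exact Real.rpow_le_rpow (by positivity) (h104 L) hω0.le
      calc B ^ (2 * k) ≤ ((q L : ℝ) ^ (ω * r L)) ^ (2 * k) := pow_le_pow_left₀ hB0 hBL _
        _ = (q L : ℝ) ^ (2 * ω * (k * r L)) := by
            rw [← Real.rpow_mul_natCast (hqR L).le]; push_cast; ring_nf
        _ ≤ (q L : ℝ) ^ (ε ^ 2 / 12 * (k * r L)) := by
            apply Real.rpow_le_rpow_of_exponent_le (hq1 L)
            have : (0 : ℝ) ≤ k * r L := by positivity
            nlinarith)
  have hi₂U : aeval (a ∘ fun _ : Fin 1 => L) (hasseD i₂ U) ≠ 0 :=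
    aeval_hasseD_ne_zero_of_smul (a ∘ fun _ : Fin 1 => L) i₂ hUsmap hi₂
  have hi₂eq : i₂ = Finsupp.single 0 (i₂ 0) := finsupp_fin_one_eq i₂
  have hi₂wt' : ((i₂ 0 : ℕ) : ℝ) / r L ≤ k * (ε ^ 2 / 12) := by
    have hkrL : (0 : ℝ) < k * r L := by
      have := Nat.mul_pos hk0 (hr0 L); exact_mod_cast this
    have hrL : (0 : ℝ) < r L := by exact_mod_cast hr0 L
    rw [wt, Fin.sum_univ_one] at hi₂wt
    push_cast at hi₂wt
    rw [div_le_iff₀ hkrL] at hi₂wt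
    rw [div_le_iff₀ hrL]
    linarith
  -- the witness for `W`
  have hfi : Function.Injective (Fin.castSucc : Fin (n + 1) → Fin (n + 2)) :=
    Fin.castSucc_injective _
  have hgi : Function.Injective (fun _ : Fin 1 => L) := fun a b _ => Subsingleton.elim a b
  have hfg : ∀ (x : Fin (n + 1)) (b : Fin 1), Fin.castSucc x ≠ (fun _ : Fin 1 => L) b :=
    fun x _ h => (Fin.castSucc_lt_last x).ne h
  set iW := snocF i₁ (i₂ 0) with hiW
  have hiWne : aeval a (hasseD iW W) ≠ 0 := by
    rw [aeval_hasseD_eq_aeval_hasseD_map, hWVU, hiW, snocF_eq_mapDomain_add, ← hi₂eq]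
    exact aeval_hasseD_sep_mul_ne_zero hfi hgi hfg a hi₁V hi₂U
  have hiWwt : wt r iW ≤ k * ε ^ 2 / 6 := by
    rw [hiW, wt_snocF]
    linarith
  exact rothLemma_of_detWitness ε hε0 hε12 r hr0 hr a P k hk0 hkL μ hμ ν hν
    ⟨iW, hiWwt, hiWne⟩

/-! ### Theorem 10A -/

/-- **Theorem 10A (Roth's Lemma)** for `n + 1` variables, `0`-indexed with `γ = 1`, by induction
on `n` (`Roth.rothLemma_base`, `Roth.rothLemma_step`). [cite: Schmidt1980, Ch. V Theorem 10A] -/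
theorem rothLemma_aux (n : ℕ) :
    ∀ (ε : ℝ), 0 < ε → ε < 1 / 12 →
      ∀ (r : Fin (n + 1) → ℕ), (∀ h, 0 < r h) →
        (∀ h h' : Fin (n + 1), (h : ℕ) + 1 = h' → (r h' : ℝ) ≤ omega (n + 1) ε * r h) →
      ∀ (p : Fin (n + 1) → ℤ) (q : Fin (n + 1) → ℕ), (∀ h, 0 < q h) →
        (∀ h, Nat.Coprime (p h).natAbs (q h)) →
        (∀ h, (q 0 : ℝ) ^ (r 0) ≤ (q h : ℝ) ^ (r h)) →
        (∀ h, (2 : ℝ) ^ (3 * (n + 1)) ≤ (q h : ℝ) ^ omega (n + 1) ε) →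
      ∀ (P : MvPolynomial (Fin (n + 1)) ℤ), P ≠ 0 → (∀ h, P.degreeOf h ≤ r h) →
        (height P : ℝ) ≤ (q 0 : ℝ) ^ (omega (n + 1) ε * r 0) →
        ∃ i : Fin (n + 1) →₀ ℕ, wt r i ≤ ε ∧ aeval (fun h => (p h : ℝ) / q h) (hasseD i P) ≠ 0 := by
  induction n with
  | zero =>
    intro ε hε0 hε12 r hr0 _ p q hq hcop _ h105 P hP _ hPht
    exact rothLemma_base ε hε0 hε12 r hr0 p q hq hcop h105 P hP hPht
  | succ n ih =>
    intro ε hε0 hε12 r hr0 hr p q hq hcop h104 h105 P hP hPdeg hPht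
    exact rothLemma_step n ih ε hε0 hε12 r hr0 hr p q hq hcop h104 h105 P hP hPdeg hPht

/-- **Theorem 10A (Roth's Lemma; Roth 1955)** as stated by Schmidt, `0`-indexed, with `γ = 1`,
in exactly the form consumed by `Roth.roth_of_rothLemma` (`RothAssembly.lean`): for `m ≥ 1`,
`0 < ε < 1/12`, positive weights with `r_{h+1} ≤ ω(m,ε) r_h` (10.3), reduced fractions `p_h/q_h`
with `q_h^{r_h} ≥ q₀^{r₀}` (10.4) and `q_h^{ω} ≥ 2^{3m}` (10.5), and an integer polynomial `P ≠ 0`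
of degree `≤ r_h` in `X_h` with `|P| ≤ q₀^{ωr₀}` (10.6), some `P_i` with `Σ i_h/r_h ≤ ε` does not
vanish at `(p₀/q₀, …, p_{m-1}/q_{m-1})`. [cite: Schmidt1980, Ch. V Theorem 10A] -/
theorem rothLemma :
    ∀ (m : ℕ) (hm : 0 < m) (ε : ℝ), 0 < ε → ε < 1 / 12 →
      ∀ (r : Fin m → ℕ), (∀ h, 0 < r h) →
        (∀ h h' : Fin m, (h : ℕ) + 1 = h' → (r h' : ℝ) ≤ omega m ε * r h) →
      ∀ (p : Fin m → ℤ) (q : Fin m → ℕ), (∀ h, 0 < q h) → (∀ h, Nat.Coprime (p h).natAbs (q h)) →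
        (∀ h, (q ⟨0, hm⟩ : ℝ) ^ (r ⟨0, hm⟩) ≤ (q h : ℝ) ^ (r h)) →
        (∀ h, (2 : ℝ) ^ (3 * m) ≤ (q h : ℝ) ^ omega m ε) →
      ∀ (P : MvPolynomial (Fin m) ℤ), P ≠ 0 → (∀ h, P.degreeOf h ≤ r h) →
        (height P : ℝ) ≤ (q ⟨0, hm⟩ : ℝ) ^ (omega m ε * r ⟨0, hm⟩) →
        ∃ i : Fin m →₀ ℕ, wt r i ≤ ε ∧ aeval (fun h => (p h : ℝ) / q h) (hasseD i P) ≠ 0 := by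
  intro m hm
  obtain ⟨n, rfl⟩ : ∃ n, m = n + 1 := ⟨m - 1, by omega⟩
  exact rothLemma_aux n

end Roth

end Literature.NumberTheory.DiophantineGeometry
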